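import Summits.Ventures.LatticeQCDFlow.Exactness.Phi4MetropolisScanEnvelope
import Mathlib.MeasureTheory.Integral.DominatedConvergence
import Literature.Analysis.FunctionSpaces.TorusLipschitzFourierH1
import HarnessLib

/-!
# Reversibility and contraction of the random-scan Metropolis operator on quadratic-growth observables (by truncation)

HONEST FRAMING: exact (Metropolis-corrected) sampling algorithms for lattice gauge theory;
figures of merit are autocorrelation/cost numbers at stated couplings and volumes; no
continuum-physics claim.  (SCALAR calibration rung S0-A: not a gauge result.)

Venture `LatticeQCDFlow` (cell pub-lqcd), topic `Exactness`; FANOUT row 2 (`s0-phi4`, LOCAL arm;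
leftover (α)).  NEW WORK of the cell: the two remaining hypotheses of the abstract locality floor
(`RevOp`, files `ReversibleOperatorL2` / `ReversibleLocalityFloor`) for the random-site-scan
Metropolis operator `metroScan J λ ρ` on the UNBOUNDED class `QuadObs`
(`Phi4MetropolisScanEnvelope`), obtained from the bounded-class facts of `Phi4MetropolisScan`
(`metroScan_reversible`, `metroScan_contraction`) by clipping the observables at level `N` and
letting `N → ∞` under the integral (dominated convergence, the quartic envelope
`(1 + Σ|φ_w|)⁴ e^{−S}` being integrable).  Nothing is cited as a fact.

## What is proved (coercive action; window step law: `ρ ≥ 0` measurable, `∫ρ = 1`, `ρ = 0` off `[−δ, δ]`)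

* `tendsto_clip`, `bddObs_clip`, `clip_quadBound` — clipping `a ↦ max(−N, min(N, a))` converges to
  `a` and keeps the envelope bound (`|clamp| ≤ |·|` is `Literature.Analysis.FunctionSpaces.abs_clamp_le_abs`);
* `abs_metroScan_le_quad`, `tendsto_metroSite_clip`, **`tendsto_metroScan_clip`** — `K(clip_N f)(φ) → K f(φ)` for every `φ`;
* **`metroScan_reversible_quad`** — `∫ (Kf) g e^{−S} = ∫ f (Kg) e^{−S}` for `f, g ∈ QuadObs`;
* **`metroScan_contraction_quad`** — `∫ (Kf)² e^{−S} ≤ ∫ f² e^{−S}` for `f ∈ QuadObs`.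

With `Phi4MetropolisScanEnvelope` this makes `QuadObs` an admissible class for `RevOp`; the
magnetisation floor is drawn in `Exactness/Phi4MetropolisMagnetisationCSD.lean`.
-/

namespace Summit.Ventures.LatticeQCDFlow.Exactness

open Real MeasureTheory Filter Finset Topology
open Summit.Ventures.LatticeQCDFlow.Scoring

section EnvelopeDCT

variable {n : ℕ}

/-- Clipping at level `N → ∞` converges: `max(−N, min(N, a)) → a` (eventually constant). -/
theorem tendsto_clip (a : ℝ) :
    Tendsto (fun N : ℕ => max (-(N : ℝ)) (min (N : ℝ) a)) atTop (𝓝 a) := by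
  refine tendsto_const_nhds.congr' ?_
  rw [EventuallyEq, eventually_atTop]
  refine ⟨⌈|a|⌉₊, fun N hN => ?_⟩
  have hN : |a| ≤ (N : ℝ) := (Nat.le_ceil |a|).trans (by exact_mod_cast hN)
  have h1 : min (N : ℝ) a = a := min_eq_right ((le_abs_self a).trans hN)
  rw [h1]
  exact (max_eq_right (by linarith [neg_abs_le a])).symm

/-- The clipped observable is bounded and measurable. -/
theorem bddObs_clip {f : (Fin (n + 1) → ℝ) → ℝ} (hfm : Measurable f) (N : ℕ) :
    BddObs (fun φ => max (-(N : ℝ)) (min (N : ℝ) (f φ))) := by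
  refine ⟨measurable_const.max (measurable_const.min hfm), N, fun φ => abs_le.mpr ⟨?_, ?_⟩⟩
  · exact le_max_left _ _
  · exact max_le (by linarith [(Nat.cast_nonneg N : (0 : ℝ) ≤ N)]) (min_le_left _ _)

/-- The clipped observable keeps the quadratic envelope bound of the original (same constant). -/
theorem clip_quadBound {f : (Fin (n + 1) → ℝ) → ℝ} {B : ℝ}
    (hfb : ∀ φ, |f φ| ≤ B * (1 + ∑ w, |φ w|) ^ 2) (N : ℕ) (φ : Fin (n + 1) → ℝ) :
    |max (-(N : ℝ)) (min (N : ℝ) (f φ))| ≤ B * (1 + ∑ w, |φ w|) ^ 2 :=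
  (Literature.Analysis.FunctionSpaces.abs_clamp_le_abs (Nat.cast_nonneg N) (f φ)).trans (hfb φ)

/-- Envelope bound for the scan with the SAME constant as the observable:
`|K f (φ)| ≤ B (1+δ)² (1 + Σ_w |φ_w|)²`. -/
theorem abs_metroScan_le_quad (J : Fin (n + 1) → Fin (n + 1) → ℝ) (lam : ℝ) {ρ : ℝ → ℝ}
    (hρ0 : ∀ u, 0 ≤ ρ u) (hρm : Measurable ρ) (hρi : Integrable ρ) (hρ1 : ∫ u, ρ u = 1)
    {δ : ℝ} (hδ : 0 ≤ δ) (hρδ : ∀ u, δ < |u| → ρ u = 0) {f : (Fin (n + 1) → ℝ) → ℝ}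
    (hfm : Measurable f) {B : ℝ} (hfb : ∀ φ, |f φ| ≤ B * (1 + ∑ w, |φ w|) ^ 2)
    (φ : Fin (n + 1) → ℝ) :
    |metroScan J lam ρ f φ| ≤ B * (1 + δ) ^ 2 * (1 + ∑ w, |φ w|) ^ 2 := by
  have hn : (0 : ℝ) < (n : ℝ) + 1 := by positivity
  unfold metroScan
  rw [abs_div, abs_of_pos hn, div_le_iff₀ hn]
  calc |∑ x, metroSite J lam ρ x f φ| ≤ ∑ x, |metroSite J lam ρ x f φ| :=
        Finset.abs_sum_le_sum_abs _ _
    _ ≤ ∑ _x : Fin (n + 1), B * (1 + δ) ^ 2 * (1 + ∑ w, |φ w|) ^ 2 :=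
        Finset.sum_le_sum fun x _ => abs_metroSite_le_quad J lam hρ0 hρm hρi hρ1 hδ hρδ x hfm hfb φ
    _ = B * (1 + δ) ^ 2 * (1 + ∑ w, |φ w|) ^ 2 * ((n : ℝ) + 1) := by
        rw [Finset.sum_const, Finset.card_univ, Fintype.card_fin, nsmul_eq_mul]
        push_cast
        ring

/-- **Truncation under the hit**: `M_x(clip_N f)(φ) → M_x f(φ)` as `N → ∞`, for `f ∈ QuadObs` and
the window step law (dominated convergence in the proposal variable). -/
theorem tendsto_metroSite_clip (J : Fin (n + 1) → Fin (n + 1) → ℝ) (lam : ℝ) {ρ : ℝ → ℝ}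
    (hρ0 : ∀ u, 0 ≤ ρ u) (hρm : Measurable ρ) (hρi : Integrable ρ) {δ : ℝ} (hδ : 0 ≤ δ)
    (hρδ : ∀ u, δ < |u| → ρ u = 0) (x : Fin (n + 1)) {f : (Fin (n + 1) → ℝ) → ℝ}
    (hfm : Measurable f) {B : ℝ} (hfb : ∀ φ, |f φ| ≤ B * (1 + ∑ w, |φ w|) ^ 2)
    (φ : Fin (n + 1) → ℝ) :
    Tendsto (fun N : ℕ => metroSite J lam ρ x (fun ψ => max (-(N : ℝ)) (min (N : ℝ) (f ψ))) φ)
      atTop (𝓝 (metroSite J lam ρ x f φ)) := by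
  unfold metroSite
  have hρt : Integrable (fun t' => ρ (t' - φ x)) := hρi.comp_sub_right (φ x)
  refine tendsto_integral_of_dominated_convergence
    (fun t' => B * (1 + δ) ^ 2 * (1 + ∑ w, |φ w|) ^ 2 * ρ (t' - φ x)) (fun N => ?_)
    (hρt.const_mul _) (fun N => Eventually.of_forall fun t' => ?_) (Eventually.of_forall fun t' => ?_)
  · exact (integrable_metroSite_integrand_quad J lam hρ0 hρm hρi hδ hρδ x
      (measurable_const.max (measurable_const.min hfm)) (clip_quadBound hfb N) φ).1.aestronglyMeasurable
  · exact (integrable_metroSite_integrand_quad J lam hρ0 hρm hρi hδ hρδ x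
      (measurable_const.max (measurable_const.min hfm)) (clip_quadBound hfb N) φ).2 t'
  · exact (((tendsto_clip (f (Function.update φ x t'))).const_mul _).add
      ((tendsto_clip (f φ)).const_mul _)).mul_const _

/-- **Truncation under the scan**: `K(clip_N f)(φ) → K f(φ)` as `N → ∞`. -/
theorem tendsto_metroScan_clip (J : Fin (n + 1) → Fin (n + 1) → ℝ) (lam : ℝ) {ρ : ℝ → ℝ}
    (hρ0 : ∀ u, 0 ≤ ρ u) (hρm : Measurable ρ) (hρi : Integrable ρ) {δ : ℝ} (hδ : 0 ≤ δ)
    (hρδ : ∀ u, δ < |u| → ρ u = 0) {f : (Fin (n + 1) → ℝ) → ℝ}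
    (hfm : Measurable f) {B : ℝ} (hfb : ∀ φ, |f φ| ≤ B * (1 + ∑ w, |φ w|) ^ 2)
    (φ : Fin (n + 1) → ℝ) :
    Tendsto (fun N : ℕ => metroScan J lam ρ (fun ψ => max (-(N : ℝ)) (min (N : ℝ) (f ψ))) φ)
      atTop (𝓝 (metroScan J lam ρ f φ)) := by
  unfold metroScan
  exact (tendsto_finsetSum _ fun x _ =>
    tendsto_metroSite_clip J lam hρ0 hρm hρi hδ hρδ x hfm hfb φ).div_const _

/-- **THE RANDOM-SITE SCAN IS REVERSIBLE ON QUADRATIC-GROWTH OBSERVABLES**: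
`∫ (Kf) g e^{−S} = ∫ f (Kg) e^{−S}` for `f, g ∈ QuadObs` (coercive action, window step law) —
from the bounded case by clipping both observables and dominated convergence. -/
theorem metroScan_reversible_quad {J : Fin (n + 1) → Fin (n + 1) → ℝ} {lam ε K : ℝ} (hε : 0 < ε)
    (hS : ∀ φ : Fin (n + 1) → ℝ, ε * ∑ w, φ w ^ 2 - K ≤ latticePhi4Action J lam φ)
    {ρ : ℝ → ℝ} (hρ0 : ∀ u, 0 ≤ ρ u) (hρm : Measurable ρ) (hρi : Integrable ρ)
    (hρ1 : ∫ u, ρ u = 1) (hρs : ∀ u, ρ (-u) = ρ u) {δ : ℝ} (hδ : 0 ≤ δ)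
    (hρδ : ∀ u, δ < |u| → ρ u = 0) {f g : (Fin (n + 1) → ℝ) → ℝ}
    (hf : QuadObs f) (hg : QuadObs g) :
    ∫ φ, metroScan J lam ρ f φ * g φ * gibbsWeight J lam φ
      = ∫ φ, f φ * metroScan J lam ρ g φ * gibbsWeight J lam φ := by
  obtain ⟨hfm, Bf, hfb⟩ := hf
  obtain ⟨hgm, Bg, hgb⟩ := hg
  have hBf := quadObs_const_nonneg hfb
  have hBg := quadObs_const_nonneg hgb
  have hE4 := integrable_quartic_envelope_mul_gibbsWeight hε hS
  have hwm : Measurable (gibbsWeight J lam) := (continuous_gibbsWeight J lam).measurable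
  set fN : ℕ → (Fin (n + 1) → ℝ) → ℝ := fun N ψ => max (-(N : ℝ)) (min (N : ℝ) (f ψ)) with hfN
  set gN : ℕ → (Fin (n + 1) → ℝ) → ℝ := fun N ψ => max (-(N : ℝ)) (min (N : ℝ) (g ψ)) with hgN
  have hfNb : ∀ N, BddObs (fN N) := fun N => bddObs_clip hfm N
  have hgNb : ∀ N, BddObs (gN N) := fun N => bddObs_clip hgm N
  -- the bounded identity at every clip level
  have hN : ∀ N, ∫ φ, metroScan J lam ρ (fN N) φ * gN N φ * gibbsWeight J lam φ
      = ∫ φ, fN N φ * metroScan J lam ρ (gN N) φ * gibbsWeight J lam φ :=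
    fun N => metroScan_reversible hε hS hρ0 hρm hρi hρ1 hρs (hfNb N) (hgNb N)
  -- envelope bounds, uniform in `N`
  have hKfN : ∀ N φ, |metroScan J lam ρ (fN N) φ| ≤ Bf * (1 + δ) ^ 2 * (1 + ∑ w, |φ w|) ^ 2 :=
    fun N φ => abs_metroScan_le_quad J lam hρ0 hρm hρi hρ1 hδ hρδ (hfNb N).1 (clip_quadBound hfb N) φ
  have hKgN : ∀ N φ, |metroScan J lam ρ (gN N) φ| ≤ Bg * (1 + δ) ^ 2 * (1 + ∑ w, |φ w|) ^ 2 :=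
    fun N φ => abs_metroScan_le_quad J lam hρ0 hρm hρi hρ1 hδ hρδ (hgNb N).1 (clip_quadBound hgb N) φ
  -- left-hand sides converge
  have hL : Tendsto (fun N => ∫ φ, metroScan J lam ρ (fN N) φ * gN N φ * gibbsWeight J lam φ)
      atTop (𝓝 (∫ φ, metroScan J lam ρ f φ * g φ * gibbsWeight J lam φ)) := by
    refine tendsto_integral_of_dominated_convergence
      (fun φ => Bf * (1 + δ) ^ 2 * Bg * ((1 + ∑ w, |φ w|) ^ 4 * gibbsWeight J lam φ))
      (fun N => (((bddObs_metroScan J lam hρ0 hρm hρi hρ1 (hfNb N)).1.mul (hgNb N).1).mul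
        hwm).aestronglyMeasurable)
      (hE4.const_mul _) (fun N => Eventually.of_forall fun φ => ?_)
      (Eventually.of_forall fun φ => ?_)
    · have hw := gibbsWeight_pos J lam φ
      rw [Real.norm_eq_abs, abs_mul, abs_mul, abs_of_pos hw]
      have hE : 0 ≤ (1 + ∑ w, |φ w|) ^ 2 := by positivity
      calc |metroScan J lam ρ (fN N) φ| * |gN N φ| * gibbsWeight J lam φ
          ≤ Bf * (1 + δ) ^ 2 * (1 + ∑ w, |φ w|) ^ 2 * (Bg * (1 + ∑ w, |φ w|) ^ 2)
            * gibbsWeight J lam φ := by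
            refine mul_le_mul_of_nonneg_right ?_ hw.le
            exact mul_le_mul (hKfN N φ) (clip_quadBound hgb N φ) (abs_nonneg _)
              (mul_nonneg (mul_nonneg hBf (sq_nonneg _)) hE)
        _ = Bf * (1 + δ) ^ 2 * Bg * ((1 + ∑ w, |φ w|) ^ 4 * gibbsWeight J lam φ) := by ring
    · exact ((tendsto_metroScan_clip J lam hρ0 hρm hρi hδ hρδ hfm hfb φ).mul
        (tendsto_clip (g φ))).mul_const _
  -- right-hand sides converge
  have hR : Tendsto (fun N => ∫ φ, fN N φ * metroScan J lam ρ (gN N) φ * gibbsWeight J lam φ)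
      atTop (𝓝 (∫ φ, f φ * metroScan J lam ρ g φ * gibbsWeight J lam φ)) := by
    refine tendsto_integral_of_dominated_convergence
      (fun φ => Bf * (Bg * (1 + δ) ^ 2) * ((1 + ∑ w, |φ w|) ^ 4 * gibbsWeight J lam φ))
      (fun N => (((hfNb N).1.mul (bddObs_metroScan J lam hρ0 hρm hρi hρ1 (hgNb N)).1).mul
        hwm).aestronglyMeasurable)
      (hE4.const_mul _) (fun N => Eventually.of_forall fun φ => ?_)
      (Eventually.of_forall fun φ => ?_)
    · have hw := gibbsWeight_pos J lam φ
      rw [Real.norm_eq_abs, abs_mul, abs_mul, abs_of_pos hw]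
      have hE : 0 ≤ (1 + ∑ w, |φ w|) ^ 2 := by positivity
      calc |fN N φ| * |metroScan J lam ρ (gN N) φ| * gibbsWeight J lam φ
          ≤ Bf * (1 + ∑ w, |φ w|) ^ 2 * (Bg * (1 + δ) ^ 2 * (1 + ∑ w, |φ w|) ^ 2)
            * gibbsWeight J lam φ := by
            refine mul_le_mul_of_nonneg_right ?_ hw.le
            exact mul_le_mul (clip_quadBound hfb N φ) (hKgN N φ) (abs_nonneg _) (mul_nonneg hBf hE)
        _ = Bf * (Bg * (1 + δ) ^ 2) * ((1 + ∑ w, |φ w|) ^ 4 * gibbsWeight J lam φ) := by ring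
    · exact ((tendsto_clip (f φ)).mul
        (tendsto_metroScan_clip J lam hρ0 hρm hρi hδ hρδ hgm hgb φ)).mul_const _
  have hL' : Tendsto (fun N => ∫ φ, metroScan J lam ρ (fN N) φ * gN N φ * gibbsWeight J lam φ)
      atTop (𝓝 (∫ φ, f φ * metroScan J lam ρ g φ * gibbsWeight J lam φ)) := by
    simp_rw [hN]
    exact hR
  exact tendsto_nhds_unique hL hL'

/-- **THE RANDOM-SITE SCAN IS AN `L²(e^{−S})` CONTRACTION ON QUADRATIC-GROWTH OBSERVABLES**:
`∫ (Kf)² e^{−S} ≤ ∫ f² e^{−S}` for `f ∈ QuadObs` — from the bounded case by clipping and dominated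
convergence on both sides. -/
theorem metroScan_contraction_quad {J : Fin (n + 1) → Fin (n + 1) → ℝ} {lam ε K : ℝ} (hε : 0 < ε)
    (hS : ∀ φ : Fin (n + 1) → ℝ, ε * ∑ w, φ w ^ 2 - K ≤ latticePhi4Action J lam φ)
    {ρ : ℝ → ℝ} (hρ0 : ∀ u, 0 ≤ ρ u) (hρm : Measurable ρ) (hρi : Integrable ρ)
    (hρ1 : ∫ u, ρ u = 1) (hρs : ∀ u, ρ (-u) = ρ u) {δ : ℝ} (hδ : 0 ≤ δ)
    (hρδ : ∀ u, δ < |u| → ρ u = 0) {f : (Fin (n + 1) → ℝ) → ℝ} (hf : QuadObs f) :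
    ∫ φ, metroScan J lam ρ f φ ^ 2 * gibbsWeight J lam φ ≤ ∫ φ, f φ ^ 2 * gibbsWeight J lam φ := by
  obtain ⟨hfm, Bf, hfb⟩ := hf
  have hBf := quadObs_const_nonneg hfb
  have hE4 := integrable_quartic_envelope_mul_gibbsWeight hε hS
  have hwm : Measurable (gibbsWeight J lam) := (continuous_gibbsWeight J lam).measurable
  set fN : ℕ → (Fin (n + 1) → ℝ) → ℝ := fun N ψ => max (-(N : ℝ)) (min (N : ℝ) (f ψ)) with hfN
  have hfNb : ∀ N, BddObs (fN N) := fun N => bddObs_clip hfm N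
  have hN : ∀ N, ∫ φ, metroScan J lam ρ (fN N) φ ^ 2 * gibbsWeight J lam φ
      ≤ ∫ φ, fN N φ ^ 2 * gibbsWeight J lam φ :=
    fun N => metroScan_contraction hε hS hρ0 hρm hρi hρ1 hρs (hfNb N)
  have hKfN : ∀ N φ, |metroScan J lam ρ (fN N) φ| ≤ Bf * (1 + δ) ^ 2 * (1 + ∑ w, |φ w|) ^ 2 :=
    fun N φ => abs_metroScan_le_quad J lam hρ0 hρm hρi hρ1 hδ hρδ (hfNb N).1 (clip_quadBound hfb N) φ
  have hL : Tendsto (fun N => ∫ φ, metroScan J lam ρ (fN N) φ ^ 2 * gibbsWeight J lam φ)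
      atTop (𝓝 (∫ φ, metroScan J lam ρ f φ ^ 2 * gibbsWeight J lam φ)) := by
    refine tendsto_integral_of_dominated_convergence
      (fun φ => (Bf * (1 + δ) ^ 2) ^ 2 * ((1 + ∑ w, |φ w|) ^ 4 * gibbsWeight J lam φ))
      (fun N => (((bddObs_metroScan J lam hρ0 hρm hρi hρ1 (hfNb N)).1.pow_const 2).mul
        hwm).aestronglyMeasurable)
      (hE4.const_mul _) (fun N => Eventually.of_forall fun φ => ?_)
      (Eventually.of_forall fun φ => ?_)
    · have hw := gibbsWeight_pos J lam φ
      rw [Real.norm_eq_abs, abs_mul, abs_of_pos hw, abs_pow]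
      calc |metroScan J lam ρ (fN N) φ| ^ 2 * gibbsWeight J lam φ
          ≤ (Bf * (1 + δ) ^ 2 * (1 + ∑ w, |φ w|) ^ 2) ^ 2 * gibbsWeight J lam φ :=
            mul_le_mul_of_nonneg_right (pow_le_pow_left₀ (abs_nonneg _) (hKfN N φ) 2) hw.le
        _ = (Bf * (1 + δ) ^ 2) ^ 2 * ((1 + ∑ w, |φ w|) ^ 4 * gibbsWeight J lam φ) := by ring
    · exact ((tendsto_metroScan_clip J lam hρ0 hρm hρi hδ hρδ hfm hfb φ).pow 2).mul_const _
  have hR : Tendsto (fun N => ∫ φ, fN N φ ^ 2 * gibbsWeight J lam φ)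
      atTop (𝓝 (∫ φ, f φ ^ 2 * gibbsWeight J lam φ)) := by
    refine tendsto_integral_of_dominated_convergence
      (fun φ => Bf ^ 2 * ((1 + ∑ w, |φ w|) ^ 4 * gibbsWeight J lam φ))
      (fun N => (((hfNb N).1.pow_const 2).mul hwm).aestronglyMeasurable)
      (hE4.const_mul _) (fun N => Eventually.of_forall fun φ => ?_)
      (Eventually.of_forall fun φ => ?_)
    · have hw := gibbsWeight_pos J lam φ
      rw [Real.norm_eq_abs, abs_mul, abs_of_pos hw, abs_pow]
      calc |fN N φ| ^ 2 * gibbsWeight J lam φ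
          ≤ (Bf * (1 + ∑ w, |φ w|) ^ 2) ^ 2 * gibbsWeight J lam φ :=
            mul_le_mul_of_nonneg_right (pow_le_pow_left₀ (abs_nonneg _) (clip_quadBound hfb N φ) 2)
              hw.le
        _ = Bf ^ 2 * ((1 + ∑ w, |φ w|) ^ 4 * gibbsWeight J lam φ) := by ring
    · exact ((tendsto_clip (f φ)).pow 2).mul_const _
  exact le_of_tendsto_of_tendsto' hL hR hN

end EnvelopeDCT

end Summit.Ventures.LatticeQCDFlow.Exactness
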